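import Summits.QuantumFields.YangMills.Theses.SqueezedSkewness
import Summits.QuantumFields.YangMills.Theorems.LangevinControlUVOSLegsFromFemtoAndGapStubCollar6

/-!
# Birth skeleton — LINE «seam on the shared boundary law» (planner ym-idea-6 g11): split of
`SqueezedSkewness.ElectricSeamH` (stmt-QuantumFields-23203) into `SeamFromMoments` (23395, support — content LANDED as
`Theorems.ThermalDescentSeamFromMoments.seamFromMoments`) + `FloorUnitMomentsH` (23396, crux: the spine's `MomentBounds6`
at the slab-floor unit) + the generated glue `ElectricSeamHGlue` (23397, S).

The point of the line is the UPSTREAM REDUCTION, kernel-checked below: `FloorUnitMomentsH` follows from LINE 1's shared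
crux `FloorUnitFBL6` (23389) by the LANDED collar transfer `DlrCollarTransfer.stub_collar6 : FBL6 → MomentBounds6`
(second disjunct of `FloorUnitFBL6`'s hypothesis).  Hence ONE engine-grade item (23389) feeds both E0′ ceilings
(`AntipodalMirrorCeiling`, `ElectricSeamH`) of the route.  Sorries: the three stubs (`stub_seamFromMoments` is a one-line port of a LANDED theorem, see its docstring).  No summit / NT statement is proved here. -/

set_option autoImplicit false

namespace Summit.QuantumFields.YangMills.Cruxes.NT.ElectricSeamFBL6Birth

open Summit.QuantumFields.YangMills.Theses.SqueezedSkewness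

namespace __Registered

/-- = the split child `SqueezedSkewness.SeamFromMoments` (23395) BY NAME (= `ThermalDescent.SeamFromMoments` by `rfl`). -/
abbrev stub_seamFromMoments : Prop :=
  Summit.QuantumFields.YangMills.Theses.SqueezedSkewness.SeamFromMoments

/-- = the split child `SqueezedSkewness.FloorUnitMomentsH` (23396) BY NAME. -/
abbrev stub_floorUnitMomentsH : Prop :=
  Summit.QuantumFields.YangMills.Theses.SqueezedSkewness.FloorUnitMomentsH

/-- = LINE 1's shared crux `SqueezedSkewness.FloorUnitFBL6` (23389) BY NAME — the upstream of `stub_floorUnitMomentsH`. -/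
abbrev stub_floorUnitFBL6 : Prop :=
  Summit.QuantumFields.YangMills.Theses.SqueezedSkewness.FloorUnitFBL6

end __Registered

/-- stub (support, S): content LANDED as `Summit.QuantumFields.YangMills.Theorems.ThermalDescentSeamFromMoments.seamFromMoments :
ThermalDescent.SeamFromMoments` (p662065), and `SqueezedSkewness.SeamFromMoments = ThermalDescent.SeamFromMoments` holds by `rfl`
(checked in the planner's folder; the ThermalDescent import is left out of this workfile only to keep it independent of that
route file's rebuilds) — closing it is the one-line port `:= ThermalDescentSeamFromMoments.seamFromMoments`. -/
theorem stub_seamFromMoments : __Registered.stub_seamFromMoments := by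
  sorry

/-- stub (crux, XL stand-alone / S given `FloorUnitFBL6`): `MomentBounds6` at the slab-floor unit. OPEN. -/
theorem stub_floorUnitMomentsH : __Registered.stub_floorUnitMomentsH := by
  sorry

/-- stub (crux, XL; LINE 1's shared item 23389): the femto boundary law at floor-calibrated units. OPEN. -/
theorem stub_floorUnitFBL6 : __Registered.stub_floorUnitFBL6 := by
  sorry

/-- **Upstream reduction (kernel-checked, no sorry of its own):** `FloorUnitFBL6 → FloorUnitMomentsH` by the landed
collar transfer `stub_collar6` through `Or.inr`. -/
theorem floorUnitMomentsH_of_floorUnitFBL6 (h2 : __Registered.stub_floorUnitFBL6) : __Registered.stub_floorUnitMomentsH := by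
  intro G _ _ _ _ hG r a ha ha0 St Cfg cc posE P A w E Cov refl B Qrp v δ₁ δ₂ hδ hsupp hfl
  letI : MeasurableSpace G := borel G
  haveI : BorelSpace G := ⟨rfl⟩
  have hF := h2 G hG r a ha ha0 (Or.inr ⟨v, δ₁, δ₂, hδ, hsupp, hfl⟩)
  exact Summit.QuantumFields.YangMills.Cruxes.OSLegsFromFemtoAndGap.DlrCollarTransfer.stub_collar6 G r a hF

/-- **ElectricSeamH_of** — the crux BY NAME from the two registered stubs (= the generated glue `ElectricSeamHGlue`, S). -/
theorem ElectricSeamH_of (h1 : __Registered.stub_seamFromMoments) (h2 : __Registered.stub_floorUnitMomentsH) :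
    ElectricSeamH := by
  intro G _ _ _ _ hG r a ha ha0 St Cfg cc posE P A Ael w E Cov refl B Qrp D Drp v δ₁ δ₂ hδ hsupp hfl η hη
  exact h1 G hG r a ha ha0 (h2 G hG r a ha ha0 v δ₁ δ₂ hδ hsupp hfl) v δ₁ δ₂ hδ hsupp η hη

/-- The glue item itself, proved (port target: `Theorems/SqueezedSkewnessElectricSeamHGlue.lean`). -/
theorem electricSeamHGlue_proof : ElectricSeamHGlue := ElectricSeamH_of

/-- ElectricSeamH from LINE 1's shared crux alone (all other inputs landed). -/
theorem electricSeamH_of_floorUnitFBL6 (h : __Registered.stub_floorUnitFBL6) : ElectricSeamH :=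
  ElectricSeamH_of stub_seamFromMoments (floorUnitMomentsH_of_floorUnitFBL6 h)

theorem electricSeamH_holds_of_stubs : ElectricSeamH := ElectricSeamH_of stub_seamFromMoments stub_floorUnitMomentsH

end Summit.QuantumFields.YangMills.Cruxes.NT.ElectricSeamFBL6Birth
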